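import Summits.AtomisticToContinuum.BoseEinsteinCondensation.Theorems.BECCutLineWeakDisorderDefs
import Literature.MathematicalPhysics.QuantumManyBody.SwapPurity
import HarnessLib

/-!
# Route `BECCutLineWeakDisorder`, crux `TwoReplicaTransienceBound` (stmt-AtomisticToContinuum-9687),
# line `SketchIdeator1` (tracer decoupling): stub `stub_factorisation`

Support file (`--supports stmt-AtomisticToContinuum-9687`): proves the registered stub
`stub_factorisation : Goal.stub_factorisation` (statement `Factorisation` of
`Theorems/BECCutLineWeakDisorderDefs.lean`).
-/

noncomputable section

namespace Summit.AtomisticToContinuum.BoseEinsteinCondensation.Cruxes.TwoReplicaTransienceBound.TracerDecoupling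

open MeasureTheory Filter Set
open scoped ENNReal NNReal Topology BigOperators
open Literature.MathematicalPhysics.QuantumManyBody.BoseGas
open Literature.Probability.Process (brownian)

/-! ### Splitting `PathSpace (n+1) ≅ (one line) × PathSpace n` along `Fin.cons` (helpers) -/

namespace TracerFactorisation

variable {n : ℕ}

/-- The tagged line (coordinate `0`) of the sample `Fin.cons ω₀ ωb` started at `x :: Y`. -/
theorem worldLine_vecCons_cons_zero (x : Space) (Y : Config n) (ω₀ : Fin 3 → (ℝ≥0 → ℝ))
    (ωb : PathSpace n) (s : ℝ≥0) :
    worldLine (Matrix.vecCons x Y) (Fin.cons ω₀ ωb) s 0 =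
      x + WithLp.toLp 2 (fun k => Real.sqrt 2 * brownian s (ω₀ k)) := by
  simp [worldLine]

/-- The bath lines (coordinates `j.succ`) of the sample `Fin.cons ω₀ ωb` started at `x :: Y` are the
world-lines of `ωb` started at `Y`. -/
theorem worldLine_vecCons_cons_succ (x : Space) (Y : Config n) (ω₀ : Fin 3 → (ℝ≥0 → ℝ))
    (ωb : PathSpace n) (s : ℝ≥0) (j : Fin n) :
    worldLine (Matrix.vecCons x Y) (Fin.cons ω₀ ωb) s j.succ = worldLine Y ωb s j := by
  simp [worldLine]

/-- The one-line world-line from `x` along `ω₀`. -/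
theorem worldLine_one (x : Space) (ω₀ : Fin 3 → (ℝ≥0 → ℝ)) (s : ℝ≥0) (i : Fin 1) :
    worldLine (N := 1) (fun _ => x) (fun _ => ω₀) s i =
      x + WithLp.toLp 2 (fun k => Real.sqrt 2 * brownian s (ω₀ k)) := by
  simp [worldLine]

/-- Splitting of the survival event of `x :: Y` along `Fin.cons ω₀ ωb`: the tagged line survives
(one-line event) and the bath survives. -/
theorem cons_mem_survives_iff (L T : ℝ) (x : Space) (Y : Config n) (ω₀ : Fin 3 → (ℝ≥0 → ℝ))
    (ωb : PathSpace n) :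
    Fin.cons ω₀ ωb ∈ survives L T (Matrix.vecCons x Y) ↔
      (fun _ => ω₀) ∈ survives (N := 1) L T (fun _ => x) ∧ ωb ∈ survives L T Y := by
  simp only [survives, Set.mem_setOf_eq, boxN, Fin.forall_fin_succ, worldLine_vecCons_cons_zero,
    worldLine_vecCons_cons_succ, worldLine_one, IsEmpty.forall_iff, and_true]
  exact ⟨fun h => ⟨fun s hs => (h s hs).1, fun s hs => (h s hs).2⟩,
    fun h s hs => ⟨h.1 s hs, h.2 s hs⟩⟩

/-- Splitting of the pair interaction of `N + 1` points off the first point: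
`∑_{i<j} v(|Xᵢ - Xⱼ|) = ∑_{j ≥ 1} v(|X₀ - Xⱼ|) + ∑_{1 ≤ i < j} v(|Xᵢ - Xⱼ|)`. -/
theorem interaction_succ (v : ℝ → ℝ≥0∞) (X : Config (n + 1)) :
    interaction v X =
      (∑ j : Fin n, v (dist (X 0) (X j.succ))) + interaction v (fun j => X j.succ) := by
  simp only [interaction, Finset.sum_filter, Fin.sum_univ_succ, Fin.succ_pos, if_true, if_false,
    zero_add, Fin.not_lt_zero, Fin.succ_lt_succ_iff]

/-- Splitting of the interaction action of `x :: Y` along `Fin.cons ω₀ ωb` into the tagged–bath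
action and the bath's own action. -/
theorem pathAction_vecCons_cons {v : ℝ → ℝ≥0∞} (hv : Measurable v) (T : ℝ) (x : Space)
    (Y : Config n) (ω₀ : Fin 3 → (ℝ≥0 → ℝ)) (ωb : PathSpace n) :
    pathAction v T (Matrix.vecCons x Y) (Fin.cons ω₀ ωb) =
      taggedBathAction v T x Y ω₀ ωb + pathAction v T Y ωb := by
  have hm : Measurable fun s : ℝ => interaction v (worldLine Y ωb s.toNNReal) :=
    (measurable_interaction hv).comp (continuous_worldLine_toNNReal Y ωb).measurable
  unfold pathAction taggedBathAction
  rw [← lintegral_add_right _ hm]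
  refine lintegral_congr fun s => ?_
  rw [interaction_succ, show (fun j => worldLine (Matrix.vecCons x Y) (Fin.cons ω₀ ωb) s.toNNReal
      j.succ) = worldLine Y ωb s.toNNReal from
    funext fun j => worldLine_vecCons_cons_succ x Y ω₀ ωb _ j]

/-- **Pointwise factorisation of the Feynman–Kac weight** of `x :: Y` along `Fin.cons ω₀ ωb`: the
bath's own weight times the tagged factor (one-line survival indicator ×
`e^{-(tagged–bath action)}`). -/
theorem fkWeight_vecCons_cons {v : ℝ → ℝ≥0∞} (hv : Measurable v) (L T : ℝ) (x : Space)
    (Y : Config n) (ω₀ : Fin 3 → (ℝ≥0 → ℝ)) (ωb : PathSpace n) :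
    fkWeight v L T (Matrix.vecCons x Y) (Fin.cons ω₀ ωb) =
      fkWeight v L T Y ωb *
        ((survives (N := 1) L T (fun _ => x)).indicator (fun _ => (1 : ℝ≥0∞)) (fun _ => ω₀) *
          expNeg (taggedBathAction v T x Y ω₀ ωb)) := by
  by_cases h : Fin.cons ω₀ ωb ∈ survives L T (Matrix.vecCons x Y)
  · obtain ⟨h₁, h₂⟩ := (cons_mem_survives_iff L T x Y ω₀ ωb).1 h
    rw [fkWeight, Set.indicator_of_mem h, fkWeight, Set.indicator_of_mem h₂,
      Set.indicator_of_mem h₁, one_mul, pathAction_vecCons_cons hv, expNeg_add, mul_comm]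
  · rw [fkWeight, Set.indicator_of_notMem h]
    rcases not_and_or.1 (fun h' => h ((cons_mem_survives_iff L T x Y ω₀ ωb).2 h')) with h₁ | h₂
    · rw [Set.indicator_of_notMem h₁, zero_mul, mul_zero]
    · rw [fkWeight, Set.indicator_of_notMem h₂, zero_mul]

/-- `wienerPaths (n+1) ≅ wienerLine ⊗ wienerPaths n` under `piFinSuccAbove … 0` (whose inverse is
`Fin.cons`). -/
theorem measurePreserving_piFinSuccAbove_wienerPaths (n : ℕ) :
    MeasurePreserving (MeasurableEquiv.piFinSuccAbove (fun _ : Fin (n + 1) => Fin 3 → (ℝ≥0 → ℝ)) 0)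
      (wienerPaths (n + 1)) (wienerLine.prod (wienerPaths n)) :=
  measurePreserving_piFinSuccAbove (fun _ : Fin (n + 1) => wienerLine) 0

/-- The inverse of `piFinSuccAbove … 0` is `Fin.cons`. -/
theorem piFinSuccAbove_symm_apply_eq_cons (n : ℕ) (p : (Fin 3 → (ℝ≥0 → ℝ)) × PathSpace n) :
    (MeasurableEquiv.piFinSuccAbove (fun _ : Fin (n + 1) => Fin 3 → (ℝ≥0 → ℝ)) 0).symm p =
      Fin.cons p.1 p.2 := by
  simp [MeasurableEquiv.piFinSuccAbove_symm_apply, Fin.insertNthEquiv, Fin.insertNth_zero']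

end TracerFactorisation

/-! ### The stub -/

open TracerFactorisation in
/-- Registered stub `stub_factorisation` of line SketchIdeator1 (statement `Factorisation`):
`Z_T(x::Y) = ∫ fkWeight v L T Y ωb · tracer v L T x Y ωb dW_n(ωb)` — disintegrate
`wienerPaths (n+1) ≅ wienerLine ⊗ wienerPaths n` along `Fin.cons`, factorise the weight pointwise
(`fkWeight_vecCons_cons`), integrate the tagged coordinates first (Tonelli). -/
theorem stub_factorisation : Goal.stub_factorisation := by
  intro n v hv L T x Y
  simp only [fkPartition, fkSemigroup, mul_one]
  set e := MeasurableEquiv.piFinSuccAbove (fun _ : Fin (n + 1) => Fin 3 → (ℝ≥0 → ℝ)) 0 with he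
  have hmp : MeasurePreserving e (wienerPaths (n + 1)) (wienerLine.prod (wienerPaths n)) :=
    measurePreserving_piFinSuccAbove_wienerPaths n
  have hF : Measurable fun p : (Fin 3 → (ℝ≥0 → ℝ)) × PathSpace n =>
      fkWeight v L T (Matrix.vecCons x Y) (e.symm p) :=
    (measurable_fkWeight hv L T _).comp e.symm.measurable
  rw [← hmp.symm.lintegral_comp_emb e.symm.measurableEmbedding,
    lintegral_prod_symm _ hF.aemeasurable]
  refine lintegral_congr fun ωb => ?_
  simp only [he, piFinSuccAbove_symm_apply_eq_cons, fkWeight_vecCons_cons hv]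
  rw [lintegral_const_mul' _ _ ((fkWeight_le_one v L T Y ωb).trans_lt ENNReal.one_lt_top).ne,
    tracer_def]

end Summit.AtomisticToContinuum.BoseEinsteinCondensation.Cruxes.TwoReplicaTransienceBound.TracerDecoupling

end
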